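import Literature.MathematicalPhysics.QuantumFieldTheory.Balaban1983to89.Node00.MultiScaleFibreChartB
import HarnessLib

/-!
# BalabanUVNodes ∕ N12 — RESTRICTION OF NODE 00's BOND-DATUM CHART `msChartB` ALONG A SUB-DATUM `𝔅 ≤ 𝔅'`: the row map, the chart factorisation, differentiability and the
# derivative by rows, and the TRANSFER OF RIGHT INVERSES with their sup ∕ ℓ¹ letters — in particular from the (b)-chart `msChart … (genSet Ω k)` to PRINT's chart
# `msChartB … (lamBondsSeq Ω k)` ([II] (2.3))

[Balaban1985Variational] = «[15]», Sect. C (44)–(48) p. 285, (82)–(83) p. 290 (the linearised averaging and its chart); [Balaban1988Convergent] = «[III]», (2.2) p. 255, (2.10)–(2.12)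
p. 256; [Balaban1984PropagatorsII] = «[II]», (2.3) p. 224 (`Λ_j` as the difference of the bond sets — print constrains FEWER bonds than reading (b)).

Cell `pub-ymgap` (HUMAN RULINGS D-0062 ∕ D-0149), WIDTH SEAT `pub-ymgap-dag-n12-w6` g24 (node N12 = [B15]; key K1⁹ `stmt-QuantumFields-27364`, `--kind proof --supports … --as helper`;
count-neutral).  THEOREMS ONLY (0 `def`, 0 `instance`, 0 `sorry`): finite-dimensional linear algebra and the chain rule over the lane's (dag-n12-c g35) `Node00/MultiScaleFibreChartB`
(`ConstrSetB`, `constrEnumB`, `msChartB`, `msChartB_apply`, `msChart_eq_msChartB_bondsDet`) and the definer's F0a `B15DeterminingSetsB` (`lamBondsSeq_subset_bondsDet`).  The row map is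
delivered EXISTENTIALLY (no new definition): consumers `obtain ⟨r, hrinj, hr⟩ := exists_rowMap_of_le h` once and feed `hr` to the other lemmas.

WHY (⚑ LOCATED-RESTRICT, pub-ymgap INBOX 2026-08-30, adopted by dag-n12-d g32 for the (ii) sizing).  A component of `msChartB … 𝔅 W U X` reads ONE constrained bond `(j, c)` and nothing
else of `𝔅` (`msChartB_apply`).  Hence along a sub-datum `𝔅 ≤ 𝔅'` (`∀ j, 𝔅 j ⊆ 𝔅' j`) the small chart is the big chart read through an injective ROW MAP `r`; it is differentiable
at `0` wherever the big one is, its derivative is the big derivative followed by the row projection, and every RIGHT INVERSE of the big derivative yields one of the small derivative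
(feed the small target vector extended by zero off `r`'s range) with the SAME operator letters.  For print's datum `lamBondsSeq Ω k ≤ bondsDet (genSet Ω k)` this transfers the
onto ∕ right-inverse layer of N12's direct road (this lineage's (P4)′ ∕ hull-count sockets, dag-n10-w1∕w4's flat right inverses) to [II] (2.3)'s bonds WITHOUT re-proof — at every base
point where the (b)-chart is differentiable (on the (b)-fibre under the small-field guard: `hasStrictFDerivAt_msChart`; e.g. the direct road's `Q_k^{s*}`-filling base point and every
(b)-minimiser).  It does NOT apply at a general point of print's larger fibre (there the (b)-chart's inward-connector rows are unconstrained and it may fail to be differentiable) —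
those readings use `msChartB` natively.

CONTENTS (namespace `Summit.QuantumFields.YangMills.BalabanUVNodes.N12ChartBRestrict`): §1 ★ `exists_rowMap_of_le`; §2 `msChartB_apply_of_rowMap`, `msChartB_eq_comp_of_rowMap`,
★ `differentiableAt_msChartB_of_rowMap`, ★ `fderiv_msChartB_apply_of_rowMap`; §3 `exists_extension_of_rowMap` (extension by zero: values on `r`, zero off its range, sup letter `≤`,
ℓ¹ sum `=`), ★★ `exists_rightInverse_of_rowMap` (universal transfer), ★★ `exists_rightInverse_sup_of_le`, ★★ `exists_rightInverse_sup_l1_of_le`; §4 PRINT ≤ (b): ★★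
`exists_rightInverse_lamBondsSeq_of_genSet`, ★★ `exists_rightInverse_lamBondsSeq_of_genSet_of_smallBelow`, `differentiableAt_msChartB_lamBondsSeq_of_smallBelow`.

HONEST FRAMING.  A transfer lemma (linear algebra + chain rule), no estimate of Bałaban's asserted or refuted; nothing about existence ∕ minimality over print's larger class (FLAG №16's
content is untouched); count-neutral helper; N12 NOT discharged; K0⁷∕K1⁹ NOT closed; counts of record unmoved; one finite 𝕋⁴ programme at fixed ε — R4 closes the conditional rung
`BalabanLadder.UV` only; the Yang–Mills mass gap (Clay) is NOT proved by any of this; nothing continuum ∕ ℝ⁴ ∕ OS.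
-/

namespace Summit.QuantumFields.YangMills.BalabanUVNodes.N12ChartBRestrict

open Literature.MathematicalPhysics.QuantumFieldTheory.Balaban1983to89
open Literature.MathematicalPhysics.QuantumFieldTheory.Balaban1983to89.Node00
open B15DeterminingSets B15DeterminingSetsB
open T4Continuum (T4Family)
open T4AdjointCovarianceUnitary (lieSU)

variable {F : T4Family} {N : ℕ} [NeZero N] {K k : ℕ} {𝔅 𝔅' : BDetSet (F.P K)}

/-! ## §1  The row map of a sub-datum -/

/-- ★ **THE ROW MAP OF A SUB-DATUM** `𝔅 ≤ 𝔅'`: an injection `r` of the enumerated constrained bonds of `𝔅` (levels `≤ k`) into those of `𝔅'` sending the row of `(j, c)` to the row of the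
SAME bond — `(constrEnumB 𝔅' k).symm (r i)` is `(j, c)` with the inherited membership. [cite: Balaban1988Convergent, (2.2) p.255, (2.10) p.256 (bookkeeping)] -/
theorem exists_rowMap_of_le (h : ∀ j, 𝔅 j ⊆ 𝔅' j) :
    ∃ r : Fin (constrCardB 𝔅 k) → Fin (constrCardB 𝔅' k), Function.Injective r ∧
      ∀ i, (constrEnumB 𝔅' k).symm (r i) =
        ⟨((constrEnumB 𝔅 k).symm i).1, ⟨((constrEnumB 𝔅 k).symm i).2.1, h _ ((constrEnumB 𝔅 k).symm i).2.2⟩⟩ := by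
  classical
  -- the inclusion on the index types
  have hginj : Function.Injective (fun x : ConstrSetB 𝔅 k => (⟨x.1, ⟨x.2.1, h _ x.2.2⟩⟩ : ConstrSetB 𝔅' k)) := by
    rintro ⟨j, c, hc⟩ ⟨j', c', hc'⟩ hxy
    simp only [Sigma.mk.inj_iff] at hxy
    obtain ⟨rfl, h2⟩ := hxy
    rw [heq_eq_eq, Subtype.mk.injEq] at h2
    subst h2
    rfl
  refine ⟨fun i => constrEnumB 𝔅' k ⟨((constrEnumB 𝔅 k).symm i).1, ⟨((constrEnumB 𝔅 k).symm i).2.1, h _ ((constrEnumB 𝔅 k).symm i).2.2⟩⟩,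
    fun i i' hii' => ?_, fun i => by simp only [Equiv.symm_apply_apply]⟩
  have h1 := (constrEnumB 𝔅' k).injective hii'
  have h2 := hginj h1
  simpa using h2

/-! ## §2  The small chart is the big chart read through the row map -/

section Chart

variable {W : MSField (F.P K) (SU N)} {U : GaugeField (F.P K) 0 (SU N)} {r : Fin (constrCardB 𝔅 k) → Fin (constrCardB 𝔅' k)}
  {h : ∀ j, 𝔅 j ⊆ 𝔅' j}

/-- Row by row: the `𝔅`-chart at row `i` IS the `𝔅'`-chart at row `r i` (a component reads its bond only, `msChartB_apply`). [cite: Balaban1985Variational, (82)–(83) p.290] -/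
theorem msChartB_apply_of_rowMap
    (hr : ∀ i, (constrEnumB 𝔅' k).symm (r i) = ⟨((constrEnumB 𝔅 k).symm i).1, ⟨((constrEnumB 𝔅 k).symm i).2.1, h _ ((constrEnumB 𝔅 k).symm i).2.2⟩⟩)
    (X : PBond (F.P K) 0 → lieSU (Fin N)) (i : Fin (constrCardB 𝔅 k)) :
    msChartB F N K k 𝔅 W U X i = msChartB F N K k 𝔅' W U X (r i) := by
  rw [msChartB_apply, msChartB_apply, hr i]

/-- As maps: `Ψ_𝔅 = (· ∘ r) ∘ Ψ_{𝔅'}`. [cite: Balaban1985Variational, (82)–(83) p.290] -/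
theorem msChartB_eq_comp_of_rowMap
    (hr : ∀ i, (constrEnumB 𝔅' k).symm (r i) = ⟨((constrEnumB 𝔅 k).symm i).1, ⟨((constrEnumB 𝔅 k).symm i).2.1, h _ ((constrEnumB 𝔅 k).symm i).2.2⟩⟩) :
    msChartB F N K k 𝔅 W U =
      (ContinuousLinearMap.pi fun i => ContinuousLinearMap.proj (R := ℝ) (φ := fun _ : Fin (constrCardB 𝔅' k) => lieSU (Fin N)) (r i)) ∘ msChartB F N K k 𝔅' W U := by
  funext X i
  rw [msChartB_apply_of_rowMap hr]
  rfl

/-- ★ **DIFFERENTIABLE WHERE THE BIG CHART IS**: `Ψ_𝔅` is a continuous linear image of `Ψ_{𝔅'}`. [cite: Balaban1985Variational, (82)–(83) p.290] -/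
theorem differentiableAt_msChartB_of_rowMap
    (hr : ∀ i, (constrEnumB 𝔅' k).symm (r i) = ⟨((constrEnumB 𝔅 k).symm i).1, ⟨((constrEnumB 𝔅 k).symm i).2.1, h _ ((constrEnumB 𝔅 k).symm i).2.2⟩⟩)
    (hd : DifferentiableAt ℝ (msChartB F N K k 𝔅' W U) 0) : DifferentiableAt ℝ (msChartB F N K k 𝔅 W U) 0 := by
  rw [msChartB_eq_comp_of_rowMap hr]
  exact (ContinuousLinearMap.differentiableAt _).comp 0 hd

/-- ★ **THE DERIVATIVE BY ROWS**: `(DΨ_𝔅(0) x)_i = (DΨ_{𝔅'}(0) x)_{r i}` whenever the big chart is differentiable at `0` (chain rule with the row-projection CLM).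
[cite: Balaban1985Variational, Sect. C (44)–(48) p.285, (83) p.290] -/
theorem fderiv_msChartB_apply_of_rowMap
    (hr : ∀ i, (constrEnumB 𝔅' k).symm (r i) = ⟨((constrEnumB 𝔅 k).symm i).1, ⟨((constrEnumB 𝔅 k).symm i).2.1, h _ ((constrEnumB 𝔅 k).symm i).2.2⟩⟩)
    (hd : DifferentiableAt ℝ (msChartB F N K k 𝔅' W U) 0) (x : PBond (F.P K) 0 → lieSU (Fin N)) (i : Fin (constrCardB 𝔅 k)) :
    fderiv ℝ (msChartB F N K k 𝔅 W U) 0 x i = fderiv ℝ (msChartB F N K k 𝔅' W U) 0 x (r i) := by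
  have hc : HasFDerivAt
      ((ContinuousLinearMap.pi fun i => ContinuousLinearMap.proj (R := ℝ) (φ := fun _ : Fin (constrCardB 𝔅' k) => lieSU (Fin N)) (r i)) ∘ msChartB F N K k 𝔅' W U)
      ((ContinuousLinearMap.pi fun i => ContinuousLinearMap.proj (R := ℝ) (φ := fun _ : Fin (constrCardB 𝔅' k) => lieSU (Fin N)) (r i)).comp
        (fderiv ℝ (msChartB F N K k 𝔅' W U) 0)) 0 :=
    (ContinuousLinearMap.hasFDerivAt _).comp 0 hd.hasFDerivAt
  rw [msChartB_eq_comp_of_rowMap hr, hc.fderiv]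
  rfl

end Chart

/-! ## §3  Extension by zero and the transfer of right inverses -/

section Transfer

variable {r : Fin (constrCardB 𝔅 k) → Fin (constrCardB 𝔅' k)}

omit [NeZero N] in
/-- **EXTENSION BY ZERO ALONG THE ROW MAP**: for every small target vector `v` there is a big one `v'` with `v' (r i) = v i`, `v' = 0` off the range of `r`, `‖v'‖ ≤ ‖v‖` (sup norms) and
`Σ_{i'} ‖v' i'‖ = Σ_i ‖v i‖`. [cite: Balaban1988Convergent, (2.2) p.255 (bookkeeping)] -/
theorem exists_extension_of_rowMap (hrinj : Function.Injective r) (v : Fin (constrCardB 𝔅 k) → lieSU (Fin N)) :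
    ∃ v' : Fin (constrCardB 𝔅' k) → lieSU (Fin N), (∀ i, v' (r i) = v i) ∧ (∀ i', i' ∉ Set.range r → v' i' = 0) ∧ ‖v'‖ ≤ ‖v‖ ∧
      ∑ i', ‖v' i'‖ = ∑ i, ‖v i‖ := by
  classical
  refine ⟨Function.extend r v 0, fun i => hrinj.extend_apply v 0 i, fun i' hi' => ?_, ?_, ?_⟩
  · rw [Function.extend_apply' _ _ _ (by simpa [Set.mem_range] using hi')]; rfl
  · refine (pi_norm_le_iff_of_nonneg (norm_nonneg v)).2 fun i' => ?_
    by_cases hi' : ∃ i, r i = i'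
    · obtain ⟨i, rfl⟩ := hi'
      rw [hrinj.extend_apply]
      exact norm_le_pi_norm v i
    · rw [Function.extend_apply' _ _ _ hi']
      simp
  · -- the sum over the big index set splits into the image of `r` (reindexed) and the rest (zeros)
    have hsplit : ∑ i', ‖Function.extend r v 0 i'‖ =
        ∑ i' ∈ Finset.univ.image r, ‖Function.extend r v 0 i'‖ + ∑ i' ∈ Finset.univ \ Finset.univ.image r, ‖Function.extend r v 0 i'‖ := by
      rw [← Finset.sum_union (Finset.disjoint_sdiff)]
      congr 1
      exact (Finset.union_sdiff_of_subset (Finset.subset_univ _)).symm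
    have hzero : ∑ i' ∈ Finset.univ \ Finset.univ.image r, ‖Function.extend r v 0 i'‖ = 0 := by
      refine Finset.sum_eq_zero fun i' hi' => ?_
      have hni : ¬ ∃ i, r i = i' := by
        intro ⟨i, hi⟩
        have : i' ∈ Finset.univ.image r := Finset.mem_image.2 ⟨i, Finset.mem_univ _, hi⟩
        exact (Finset.mem_sdiff.1 hi').2 this
      rw [Function.extend_apply' _ _ _ hni]
      simp
    rw [hsplit, hzero, add_zero, Finset.sum_image fun i _ i' _ hii' => hrinj hii']
    exact Finset.sum_congr rfl fun i _ => by rw [hrinj.extend_apply]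

variable {W : MSField (F.P K) (SU N)} {U : GaugeField (F.P K) 0 (SU N)} {h : ∀ j, 𝔅 j ⊆ 𝔅' j}

/-- ★★ **TRANSFER OF RIGHT INVERSES ALONG A SUB-DATUM (universal form)**: a right inverse `H` of `DΨ_{𝔅'}(0)` (big chart differentiable at `0`) yields a right inverse `H'` of
`DΨ_𝔅(0)` of the form `H' v = H v'` with `v'` the extension of `v` by zero along `r` — so EVERY letter of `H` stated through `‖v'‖ ≤ ‖v‖`, `Σ‖v' i'‖ = Σ‖v i‖`, `v' (r i) = v i`,
`v' = 0` off the range passes to `H'`. [cite: Balaban1985Variational, Sect. C (44)–(48) p.285; Balaban1988Convergent, (2.10)–(2.12) p.256] -/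
theorem exists_rightInverse_of_rowMap (hrinj : Function.Injective r)
    (hr : ∀ i, (constrEnumB 𝔅' k).symm (r i) = ⟨((constrEnumB 𝔅 k).symm i).1, ⟨((constrEnumB 𝔅 k).symm i).2.1, h _ ((constrEnumB 𝔅 k).symm i).2.2⟩⟩)
    (hd : DifferentiableAt ℝ (msChartB F N K k 𝔅' W U) 0)
    {H : (Fin (constrCardB 𝔅' k) → lieSU (Fin N)) → PBond (F.P K) 0 → lieSU (Fin N)}
    (hH : ∀ v', fderiv ℝ (msChartB F N K k 𝔅' W U) 0 (H v') = v') :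
    ∃ H' : (Fin (constrCardB 𝔅 k) → lieSU (Fin N)) → PBond (F.P K) 0 → lieSU (Fin N),
      (∀ v, fderiv ℝ (msChartB F N K k 𝔅 W U) 0 (H' v) = v) ∧
      ∀ v, ∃ v' : Fin (constrCardB 𝔅' k) → lieSU (Fin N), H' v = H v' ∧ (∀ i, v' (r i) = v i) ∧ (∀ i', i' ∉ Set.range r → v' i' = 0) ∧
        ‖v'‖ ≤ ‖v‖ ∧ ∑ i', ‖v' i'‖ = ∑ i, ‖v i‖ := by
  choose ext hext_r hext_off hext_norm hext_sum using fun v => exists_extension_of_rowMap (𝔅' := 𝔅') (N := N) hrinj v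
  refine ⟨fun v => H (ext v), fun v => ?_, fun v => ⟨ext v, rfl, hext_r v, hext_off v, hext_norm v, hext_sum v⟩⟩
  funext i
  rw [fderiv_msChartB_apply_of_rowMap hr hd, hH, hext_r]

/-- ★★ **RIGHT INVERSE WITH SUP LETTER**: `‖H v'‖ ≤ B‖v'‖` on `𝔅'` ⟹ a right inverse on `𝔅` with `‖H' v‖ ≤ B‖v‖` (`0 ≤ B`). [cite: Balaban1985Variational, Sect. C (44)–(48) p.285; Balaban1988Convergent, (2.10)–(2.12) p.256] -/
theorem exists_rightInverse_sup_of_le (hle : ∀ j, 𝔅 j ⊆ 𝔅' j) (hd : DifferentiableAt ℝ (msChartB F N K k 𝔅' W U) 0) {B : ℝ} (hB : 0 ≤ B)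
    {H : (Fin (constrCardB 𝔅' k) → lieSU (Fin N)) → PBond (F.P K) 0 → lieSU (Fin N)}
    (hH : ∀ v', fderiv ℝ (msChartB F N K k 𝔅' W U) 0 (H v') = v') (hHB : ∀ v', ‖H v'‖ ≤ B * ‖v'‖) :
    ∃ H' : (Fin (constrCardB 𝔅 k) → lieSU (Fin N)) → PBond (F.P K) 0 → lieSU (Fin N),
      (∀ v, fderiv ℝ (msChartB F N K k 𝔅 W U) 0 (H' v) = v) ∧ ∀ v, ‖H' v‖ ≤ B * ‖v‖ := by
  obtain ⟨r, hrinj, hr⟩ := exists_rowMap_of_le (k := k) hle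
  obtain ⟨H', hH', hlet⟩ := exists_rightInverse_of_rowMap hrinj hr hd hH
  refine ⟨H', hH', fun v => ?_⟩
  obtain ⟨v', hv', -, -, hn, -⟩ := hlet v
  rw [hv']
  exact (hHB v').trans (mul_le_mul_of_nonneg_left hn hB)

/-- ★★ **RIGHT INVERSE WITH SUP AND ℓ¹ LETTERS** (the hull-count currency `Σ_b ‖H v b‖ ≤ B₁·Σ_i ‖v i‖` together with the sup letter): both pass to the sub-datum unchanged.
[cite: Balaban1985Variational, Sect. C (44)–(48) p.285; Balaban1988Convergent, (2.10)–(2.12) p.256] -/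
theorem exists_rightInverse_sup_l1_of_le (hle : ∀ j, 𝔅 j ⊆ 𝔅' j) (hd : DifferentiableAt ℝ (msChartB F N K k 𝔅' W U) 0) {B B₁ : ℝ} (hB : 0 ≤ B)
    {H : (Fin (constrCardB 𝔅' k) → lieSU (Fin N)) → PBond (F.P K) 0 → lieSU (Fin N)}
    (hH : ∀ v', fderiv ℝ (msChartB F N K k 𝔅' W U) 0 (H v') = v') (hHB : ∀ v', ‖H v'‖ ≤ B * ‖v'‖)
    (hHB1 : ∀ v', ∑ b, ‖H v' b‖ ≤ B₁ * ∑ i', ‖v' i'‖) :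
    ∃ H' : (Fin (constrCardB 𝔅 k) → lieSU (Fin N)) → PBond (F.P K) 0 → lieSU (Fin N),
      (∀ v, fderiv ℝ (msChartB F N K k 𝔅 W U) 0 (H' v) = v) ∧ (∀ v, ‖H' v‖ ≤ B * ‖v‖) ∧ ∀ v, ∑ b, ‖H' v b‖ ≤ B₁ * ∑ i, ‖v i‖ := by
  obtain ⟨r, hrinj, hr⟩ := exists_rowMap_of_le (k := k) hle
  obtain ⟨H', hH', hlet⟩ := exists_rightInverse_of_rowMap hrinj hr hd hH
  refine ⟨H', hH', fun v => ?_, fun v => ?_⟩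
  · obtain ⟨v', hv', -, -, hn, -⟩ := hlet v
    rw [hv']
    exact (hHB v').trans (mul_le_mul_of_nonneg_left hn hB)
  · obtain ⟨v', hv', -, -, -, hs⟩ := hlet v
    rw [hv', ← hs]
    exact hHB1 v'

end Transfer

/-! ## §4  PRINT ≤ (b): from the (b)-chart of `genSet Ω k` to print's chart of `lamBondsSeq Ω k` -/

section Print

variable {Ω : ℕ → Set (Site (F.P K) 0)} {W : MSField (F.P K) (SU N)} {U : GaugeField (F.P K) 0 (SU N)}

/-- ★★ **EVERY RIGHT-INVERSE LETTER OF THE (b)-CHART PASSES TO PRINT's CHART** (`lamBondsSeq Ω k ≤ bondsDet (genSet Ω k)`, F0a; `msChart … (genSet Ω k) = msChartB … (bondsDet (genSet Ω k))`,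
`rfl`): at a base point where the (b)-chart is differentiable, a right inverse of `D(msChart … (genSet Ω k) W U)(0)` with `‖H v‖ ≤ B‖v‖` yields one of `D(msChartB … (lamBondsSeq Ω k) W U)(0)`
with the same letter. [cite: Balaban1984PropagatorsII, (2.3) p.224; Balaban1985Variational, Sect. C (44)–(48) p.285; Balaban1988Convergent, (2.10)–(2.12) p.256] -/
theorem exists_rightInverse_lamBondsSeq_of_genSet (hd : DifferentiableAt ℝ (msChart F N K k (genSet Ω k) W U) 0) {B : ℝ} (hB : 0 ≤ B)
    {H : (Fin (constrCard (genSet Ω k) k) → lieSU (Fin N)) → PBond (F.P K) 0 → lieSU (Fin N)}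
    (hH : ∀ v', fderiv ℝ (msChart F N K k (genSet Ω k) W U) 0 (H v') = v') (hHB : ∀ v', ‖H v'‖ ≤ B * ‖v'‖) :
    ∃ H' : (Fin (constrCardB (lamBondsSeq Ω k) k) → lieSU (Fin N)) → PBond (F.P K) 0 → lieSU (Fin N),
      (∀ v, fderiv ℝ (msChartB F N K k (lamBondsSeq Ω k) W U) 0 (H' v) = v) ∧ ∀ v, ‖H' v‖ ≤ B * ‖v‖ :=
  exists_rightInverse_sup_of_le (𝔅' := bondsDet (genSet Ω k)) (lamBondsSeq_subset_bondsDet Ω k) hd hB hH hHB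

/-- The (b)-chart is differentiable at `0` at a base point ON THE (b)-FIBRE under the small-field guard (`hasStrictFDerivAt_msChart`), hence so is print's chart there.
[cite: Balaban1985Variational, (82)–(83) p.290; Balaban1984PropagatorsII, (2.3) p.224] -/
theorem differentiableAt_msChartB_lamBondsSeq_of_smallBelow (hU : AgreeOn (genSet Ω k) (avgFamily (avOfRecord F N K) U) W)
    (hsb : SmallBelow (avOfRecord F N K) k U) : DifferentiableAt ℝ (msChartB F N K k (lamBondsSeq Ω k) W U) 0 := by
  obtain ⟨r, -, hr⟩ := exists_rowMap_of_le (k := k) (lamBondsSeq_subset_bondsDet Ω k (P := F.P K))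
  exact differentiableAt_msChartB_of_rowMap hr (hasStrictFDerivAt_msChart hU hsb).hasFDerivAt.differentiableAt

/-- ★★ **THE SAME, WITH DIFFERENTIABILITY DISCHARGED ON THE (b)-FIBRE UNDER THE GUARD** (`AgreeOn (genSet Ω k) (M˙U) W`, `SmallBelow k U` — e.g. the direct road's base point and every
(b)-minimiser in the small field): a right inverse of the (b)-derivative with sup letter `B` yields one of print's derivative with the same letter.
[cite: Balaban1984PropagatorsII, (2.3) p.224; Balaban1985Variational, Sect. C (44)–(48) p.285, (82)–(83) p.290; Balaban1988Convergent, (2.10)–(2.12) p.256] -/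
theorem exists_rightInverse_lamBondsSeq_of_genSet_of_smallBelow (hU : AgreeOn (genSet Ω k) (avgFamily (avOfRecord F N K) U) W)
    (hsb : SmallBelow (avOfRecord F N K) k U) {B : ℝ} (hB : 0 ≤ B)
    {H : (Fin (constrCard (genSet Ω k) k) → lieSU (Fin N)) → PBond (F.P K) 0 → lieSU (Fin N)}
    (hH : ∀ v', fderiv ℝ (msChart F N K k (genSet Ω k) W U) 0 (H v') = v') (hHB : ∀ v', ‖H v'‖ ≤ B * ‖v'‖) :
    ∃ H' : (Fin (constrCardB (lamBondsSeq Ω k) k) → lieSU (Fin N)) → PBond (F.P K) 0 → lieSU (Fin N),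
      (∀ v, fderiv ℝ (msChartB F N K k (lamBondsSeq Ω k) W U) 0 (H' v) = v) ∧ ∀ v, ‖H' v‖ ≤ B * ‖v‖ :=
  exists_rightInverse_lamBondsSeq_of_genSet (hasStrictFDerivAt_msChart hU hsb).hasFDerivAt.differentiableAt hB hH hHB

end Print

/-! ## §5  (v1.1, APPEND-ONLY) Per-row readings through the row map: levels and `Pi.single` targets — what a per-row `hrow` letter needs -/

section Rows

open scoped Matrix.Norms.L2Operator

variable {W : MSField (F.P K) (SU N)} {U : GaugeField (F.P K) 0 (SU N)} {r : Fin (constrCardB 𝔅 k) → Fin (constrCardB 𝔅' k)}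
  {h : ∀ j, 𝔅 j ⊆ 𝔅' j}

omit [NeZero N] in
/-- The row map preserves LEVELS: row `i` of `𝔅` and row `r i` of `𝔅'` sit at the same scale `j` (first component of `hr`). [cite: Balaban1988Convergent, (2.2) p.255 (bookkeeping)] -/
theorem fst_symm_rowMap
    (hr : ∀ i, (constrEnumB 𝔅' k).symm (r i) = ⟨((constrEnumB 𝔅 k).symm i).1, ⟨((constrEnumB 𝔅 k).symm i).2.1, h _ ((constrEnumB 𝔅 k).symm i).2.2⟩⟩)
    (i : Fin (constrCardB 𝔅 k)) : ((constrEnumB 𝔅' k).symm (r i)).1 = ((constrEnumB 𝔅 k).symm i).1 := by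
  rw [hr i]

/-- ★ **A PREIMAGE OF THE BIG `Pi.single (r i) ξ` IS A PREIMAGE OF THE SMALL `Pi.single i ξ`** (`r` injective, big chart differentiable at `0`): the per-row solutions of a `hrow` letter
transfer along the row map. [cite: Balaban1985Variational, Sect. C (44)–(48) p.285; Balaban1988Convergent, (2.10)–(2.12) p.256] -/
theorem fderiv_eq_single_of_rowMap (hrinj : Function.Injective r)
    (hr : ∀ i, (constrEnumB 𝔅' k).symm (r i) = ⟨((constrEnumB 𝔅 k).symm i).1, ⟨((constrEnumB 𝔅 k).symm i).2.1, h _ ((constrEnumB 𝔅 k).symm i).2.2⟩⟩)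
    (hd : DifferentiableAt ℝ (msChartB F N K k 𝔅' W U) 0) {x : PBond (F.P K) 0 → lieSU (Fin N)} {i : Fin (constrCardB 𝔅 k)} {ξ : lieSU (Fin N)}
    (hx : fderiv ℝ (msChartB F N K k 𝔅' W U) 0 x = Pi.single (r i) ξ) :
    fderiv ℝ (msChartB F N K k 𝔅 W U) 0 x = Pi.single i ξ := by
  classical
  funext i'
  rw [fderiv_msChartB_apply_of_rowMap hr hd, hx]
  by_cases hi : i' = i
  · subst hi
    rw [Pi.single_eq_same, Pi.single_eq_same]
  · rw [Pi.single_eq_of_ne hi, Pi.single_eq_of_ne (fun e => hi (hrinj e))]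

/-- ★★ **TRANSFER OF THE HULL-COUNT CURRENCY** (`‖H v‖ ≤ B₁·Σ‖v i‖`, `Σ_b ‖H v b‖ ≤ B₁·Σ‖v i‖`, and the per-row `hrow` letter «every row of level `≥ 1` has a preimage of `Pi.single i ξ`
with `Σ_b ‖↑x_b‖ ≤ B₁‖ξ‖`», matrix norm = `Matrix.Norms.L2Operator` as in `…DirectSurjHullCountUniformB`) along a sub-datum `𝔅 ≤ 𝔅'`: all three letters pass unchanged. [cite: Balaban1985Variational, Sect. C (44)–(48) p.285; Balaban1988Convergent, (2.10)–(2.12) p.256; Balaban1984PropagatorsII, (2.3) p.224] -/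
theorem exists_rightInverse_l1_hrow_of_le (hle : ∀ j, 𝔅 j ⊆ 𝔅' j) (hd : DifferentiableAt ℝ (msChartB F N K k 𝔅' W U) 0) {B₁ : ℝ}
    {H : (Fin (constrCardB 𝔅' k) → lieSU (Fin N)) → PBond (F.P K) 0 → lieSU (Fin N)}
    (hH : ∀ v', fderiv ℝ (msChartB F N K k 𝔅' W U) 0 (H v') = v') (hHB : ∀ v', ‖H v'‖ ≤ B₁ * ∑ i', ‖v' i'‖)
    (hHB1 : ∀ v', ∑ b, ‖H v' b‖ ≤ B₁ * ∑ i', ‖v' i'‖)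
    (hrow : ∀ i' : Fin (constrCardB 𝔅' k), 1 ≤ ((((constrEnumB 𝔅' k).symm i').1 : ℕ)) → ∀ ξ : lieSU (Fin N),
      ∃ x : PBond (F.P K) 0 → lieSU (Fin N), fderiv ℝ (msChartB F N K k 𝔅' W U) 0 x = Pi.single i' ξ ∧ ∑ b, ‖(x b : Matrix (Fin N) (Fin N) ℂ)‖ ≤ B₁ * ‖ξ‖) :
    ∃ H' : (Fin (constrCardB 𝔅 k) → lieSU (Fin N)) → PBond (F.P K) 0 → lieSU (Fin N),
      (∀ v, fderiv ℝ (msChartB F N K k 𝔅 W U) 0 (H' v) = v) ∧ (∀ v, ‖H' v‖ ≤ B₁ * ∑ i, ‖v i‖) ∧ (∀ v, ∑ b, ‖H' v b‖ ≤ B₁ * ∑ i, ‖v i‖) ∧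
      ∀ i : Fin (constrCardB 𝔅 k), 1 ≤ ((((constrEnumB 𝔅 k).symm i).1 : ℕ)) → ∀ ξ : lieSU (Fin N),
        ∃ x : PBond (F.P K) 0 → lieSU (Fin N), fderiv ℝ (msChartB F N K k 𝔅 W U) 0 x = Pi.single i ξ ∧ ∑ b, ‖(x b : Matrix (Fin N) (Fin N) ℂ)‖ ≤ B₁ * ‖ξ‖ := by
  obtain ⟨r, hrinj, hr⟩ := exists_rowMap_of_le (k := k) hle
  obtain ⟨H', hH', hlet⟩ := exists_rightInverse_of_rowMap hrinj hr hd hH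
  refine ⟨H', hH', fun v => ?_, fun v => ?_, fun i hi ξ => ?_⟩
  · obtain ⟨v', hv', -, -, -, hs⟩ := hlet v
    rw [hv', ← hs]
    exact hHB v'
  · obtain ⟨v', hv', -, -, -, hs⟩ := hlet v
    rw [hv', ← hs]
    exact hHB1 v'
  · have hi' : 1 ≤ ((((constrEnumB 𝔅' k).symm (r i)).1 : ℕ)) := by rw [fst_symm_rowMap hr]; exact hi
    obtain ⟨x, hx, hxB⟩ := hrow (r i) hi' ξ
    exact ⟨x, fderiv_eq_single_of_rowMap hrinj hr hd hx, hxB⟩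

end Rows

end Summit.QuantumFields.YangMills.BalabanUVNodes.N12ChartBRestrict
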